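import Summits.CriticalPhenomena.PercolationContinuityZ3.Theorems.SahiAEFourFunctions
import Summits.CriticalPhenomena.PercolationContinuityZ3.Theorems.SahiBoxTP2Split
import Literature.Probability.LatticeModels.AffiliationDensity

/-!
# Milgrom–Weber's Theorem 24 is an equivalence as printed; Müller–Stoyan 3.10.14 in the almost-everywhere form

Support file of the Sahi cell (`prim-sahi`, typer seat, generation 19; `--supports stmt-CriticalPhenomena-4575`).
Theorems only (no definitions, no named facts, no sorries).

[MilgromWeber1982] Appendix, Theorem 24: "Let `Z = (Z₁, …, Z_k)` have joint probability density `f`. Then `Z` is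
affiliated if and only if `f` satisfies the affiliation inequality `f(z ∨ z') f(z ∧ z') ≥ f(z) f(z')` for `μ`-almost
every `(z, z') ∈ ℝ^{2k}`, where `μ` denotes Lebesgue measure."  The tree's `AffiliationDensity.lean` (literature seat)
proves the 'only if' half (`MilgromWeber1982_thm24_onlyIf`, more generally `ae_pair_latticeCondition_of_mIsAffiliated`
for any product of locally finite reference measures).  The printed proof of the 'if' half is an induction on `k`
(conditioning on `Z₁ ∈ {z₁, z₁'}`) which "omit[s] the specification 'almost everywhere [μ]'"; taken literally under the
a.e.-PAIR hypothesis it has a gap: the step "it can be routinely verified that [`f(z₁',·) + f(z₁,·)`] is affiliated"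
uses the inequality on pairs of points SHARING the first coordinate — a null set of pairs (the same gap as in the
`2 × 2` step of Karlin–Rinott's induction).  The diagonal lemma `ae_le_of_ae_pair_le` closes it
(`SahiAESections.ae_pair_twoPoint_section_mtp2` is that very step, proved), and with the almost-everywhere four functions
theorem of `SahiAEFourFunctions.lean` the 'if' half holds exactly as printed, and:

* `MilgromWeber1982_thm24_iff` — **Theorem 24 verbatim, both directions** (Lebesgue reference measure, `∫ f < ∞`).
* `mIsAffiliated_withDensity_pi_iff_ae`, `mIsSetTP2_withDensity_pi_iff_ae` — for a law `π·f`, `π = ⊗ᵢ ρᵢ` locally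
  finite on `ℝ`, `∫ f dπ < ∞`: affiliated ⟺ set-TP₂ ⟺ `f` is MTP₂ on `π ⊗ π`-ALMOST EVERY PAIR.  This is
  [MullerStoyan2002] Thm. 3.10.14 ((i) ⟺ (ii) ⟺ (iii)) with (i) read — as its cited source Milgrom–Weber proves it —
  in the almost-everywhere-pair form; NO everywhere-MTP₂ version of the density is needed or asserted anywhere in the
  chain, and the measure-level theory (set-TP₂, affiliation, hence positive association of every conditional law on a
  sublattice, conditional increase, Sahi positivity where available) applies to a.e.-pair MTP₂ densities verbatim.
* `mIsAffiliated_iff_mIsSetTP2_of_withDensity_pi` — (iii) ⟺ (ii) for such laws, routed through the a.e.-pair density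
  condition.  (REDUNDANT as a statement: the tree already has (ii) ⟺ (iii) density-free for EVERY finite measure on
  `ℝ^ι`, `Affiliation.mIsSetTP2_iff_mIsAffiliated_pi` in `MTP2WeakClosure.lean` (Colangelo–Müller–Scarsini Thm. 1), and
  on the cube `Q_d`, `SahiBoxTP2AffiliationConverse.mIsSetTP2_iff_mIsAffiliated`; kept for the record of the alternative
  proof.)
* `isBoxTP2_withDensity_pi_of_ae` — the cell's box-TP₂ notion for a.e.-pair MTP₂ densities w.r.t. any product of
  σ-finite measures (the everywhere version is `SahiBoxTP2.IsBoxTP2.withDensity_pi`).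

No sorries, no new axioms.
-/

noncomputable section

namespace Summit.CriticalPhenomena.PercolationContinuityZ3.Theorems.SahiAEFourFunctions

open MeasureTheory Set Filter
open Literature.Probability.LatticeModels Literature.Probability.LatticeModels.Affiliation
open Summit.CriticalPhenomena.PercolationContinuityZ3.Theorems.SahiBoxTP2 (IsBoxTP2)
open scoped ENNReal SetFamily

variable {ι : Type*} [Fintype ι]

/-- **Box-TP₂ from an a.e.-pair MTP₂ density**: `(π·f)[a,b] (π·f)[a',b'] ≤ (π·f)[a∧a',b∧b'] (π·f)[a∨a',b∨b']` for all
closed boxes of `ℝ^ι`, `π` any product of σ-finite measures, `f` measurable and MTP₂ on `π ⊗ π`-a.e. pair.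
[this work] -/
theorem isBoxTP2_withDensity_pi_of_ae (μ : ι → Measure ℝ) [∀ i, SigmaFinite (μ i)] (f : (ι → ℝ) → ℝ≥0∞)
    (hf : Measurable f)
    (hMTP : ∀ᵐ p ∂(Measure.pi μ).prod (Measure.pi μ), f p.1 * f p.2 ≤ f (p.1 ⊓ p.2) * f (p.1 ⊔ p.2)) :
    IsBoxTP2 ((Measure.pi μ).withDensity f) :=
  fun a b a' b' => (mIsSetTP2_withDensity_pi_of_ae μ f hf hMTP).icc a b a' b'

/-- **Müller–Stoyan 3.10.14 (i)-a.e. ⟺ (ii)**: for `π = ⊗ᵢ ρᵢ` (locally finite `ρᵢ` on `ℝ`) and a measurable `f` with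
`∫ f dπ < ∞`, the law `π·f` is set-TP₂ if and only if `f(x) f(y) ≤ f(x ∧ y) f(x ∨ y)` for `π ⊗ π`-almost every
`(x, y)`.  (⟸: `mIsSetTP2_withDensity_pi_of_ae`; ⟹: the literature seat's `ae_pair_latticeCondition_of_mIsSetTP2`,
Besicovitch differentiation.) [this work] -/
theorem mIsSetTP2_withDensity_pi_iff_ae (ρ : ι → Measure ℝ) [∀ i, IsLocallyFiniteMeasure (ρ i)]
    (f : (ι → ℝ) → ℝ≥0∞) (hf : Measurable f) (hfin : ∫⁻ z, f z ∂Measure.pi ρ ≠ ∞) :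
    mIsSetTP2 ((Measure.pi ρ).withDensity f) ↔
      ∀ᵐ p ∂(Measure.pi ρ).prod (Measure.pi ρ), f p.1 * f p.2 ≤ f (p.1 ⊓ p.2) * f (p.1 ⊔ p.2) :=
  ⟨ae_pair_latticeCondition_of_mIsSetTP2 ρ f hf hfin, mIsSetTP2_withDensity_pi_of_ae ρ f hf⟩

/-- **Müller–Stoyan 3.10.14 (i)-a.e. ⟺ (iii) / Milgrom–Weber's Theorem 24 for a general product reference measure**:
`π·f` is affiliated (every conditional law on a measurable sublattice positively associated) if and only if `f` is
MTP₂ on `π ⊗ π`-almost every pair. [this work] -/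
theorem mIsAffiliated_withDensity_pi_iff_ae (ρ : ι → Measure ℝ) [∀ i, IsLocallyFiniteMeasure (ρ i)]
    (f : (ι → ℝ) → ℝ≥0∞) (hf : Measurable f) (hfin : ∫⁻ z, f z ∂Measure.pi ρ ≠ ∞) :
    mIsAffiliated ((Measure.pi ρ).withDensity f) ↔
      ∀ᵐ p ∂(Measure.pi ρ).prod (Measure.pi ρ), f p.1 * f p.2 ≤ f (p.1 ⊓ p.2) * f (p.1 ⊔ p.2) :=
  ⟨ae_pair_latticeCondition_of_mIsAffiliated ρ f hf hfin, mIsAffiliated_withDensity_pi_of_ae ρ f hf⟩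

/-- **Müller–Stoyan 3.10.14 (ii) ⟺ (iii) on `ℝ^ι` for laws with a density** with respect to a product of locally
finite measures (`∫ f dπ < ∞`): affiliated ⟺ set-TP₂, proved through the a.e.-pair MTP₂ condition on `f`.  As a
statement this is a special case of the tree's density-free `Affiliation.mIsSetTP2_iff_mIsAffiliated_pi` (every finite
measure on `ℝ^ι`, `MTP2WeakClosure.lean`); only the route differs. [this work] -/
theorem mIsAffiliated_iff_mIsSetTP2_of_withDensity_pi (ρ : ι → Measure ℝ) [∀ i, IsLocallyFiniteMeasure (ρ i)]
    (f : (ι → ℝ) → ℝ≥0∞) (hf : Measurable f) (hfin : ∫⁻ z, f z ∂Measure.pi ρ ≠ ∞) :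
    mIsAffiliated ((Measure.pi ρ).withDensity f) ↔ mIsSetTP2 ((Measure.pi ρ).withDensity f) :=
  ⟨fun h => mIsSetTP2_withDensity_pi_of_ae ρ f hf (ae_pair_latticeCondition_of_mIsAffiliated ρ f hf hfin h),
    fun h => h.mIsAffiliated⟩

/-- **Milgrom–Weber 1982, Appendix, Theorem 24 — verbatim, as an equivalence**: "Let `Z = (Z₁, …, Z_k)` have joint
probability density `f`. Then `Z` is affiliated if and only if `f` satisfies the affiliation inequality
`f(z ∨ z') f(z ∧ z') ≥ f(z) f(z')` for `μ`-almost every `(z, z') ∈ ℝ^{2k}`, where `μ` denotes Lebesgue measure."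
(`Z` affiliated = its law `volume·f` is `mIsAffiliated`; density hypothesis `∫ f < ∞`.)  'Only if' is the tree's
`MilgromWeber1982_thm24_onlyIf`; 'if' is `mIsAffiliated_withDensity_pi_of_ae` — the printed induction with the
diagonal lemma supplying the step that the a.e. hypothesis does not give directly. [this work] -/
theorem MilgromWeber1982_thm24_iff (f : (ι → ℝ) → ℝ≥0∞) (hf : Measurable f) (hfin : ∫⁻ z, f z ≠ ∞) :
    mIsAffiliated ((volume : Measure (ι → ℝ)).withDensity f) ↔
      ∀ᵐ p ∂(volume : Measure (ι → ℝ)).prod volume, f p.1 * f p.2 ≤ f (p.1 ⊔ p.2) * f (p.1 ⊓ p.2) := by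
  refine ⟨MilgromWeber1982_thm24_onlyIf f hf hfin, fun h => ?_⟩
  have h' : ∀ᵐ p ∂(Measure.pi fun _ : ι => (volume : Measure ℝ)).prod (Measure.pi fun _ : ι => volume),
      f p.1 * f p.2 ≤ f (p.1 ⊓ p.2) * f (p.1 ⊔ p.2) := by
    rw [← volume_pi]
    filter_upwards [h] with p hp
    rwa [mul_comm (f (p.1 ⊔ p.2))] at hp
  have key := mIsAffiliated_withDensity_pi_of_ae (fun _ : ι => (volume : Measure ℝ)) f hf h'
  rwa [← volume_pi] at key

end Summit.CriticalPhenomena.PercolationContinuityZ3.Theorems.SahiAEFourFunctions
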